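import Literature.MathematicalPhysics.KineticTheory.SiteChainExpBound
import Literature.MathematicalPhysics.KineticTheory.CellChainLangevin
import Summits.AtomisticToContinuum.FouriersLaw.Theses.MatthiessenLadder
import HarnessLib

/-!
# Prefix steady states, stub `stub_prefixExpBound`: CEHR (3.4) for the Langevin kernels of a cell chain

Crux `PrefixSteadyStates` of the Matthiessen ladder (line registered, skeleton r12), stub
`stub_prefixExpBound`: the a-priori exponential moment bound of Cuneo–Eckmann–Hairer–Rey-Bellet,
EJP **23** (2018) no. 55, §3 eq. (3.4),
`E_z e^{θH(z_t)} ≤ e^{θγ(T_L+T_R)t} e^{θH(z)}` for `0 < θ < 1/max(T_L, T_R)`,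
for the Langevin kernels `(cellChain ω₂ lam β γ c).langevinKernel N T_L T_R` of every cell chain
(`ω₂ > 0`, `lam, β ≥ 0`, `γ > 0`, `N ≥ 1`, `T_L, T_R > 0`). It is the specialisation of
`SiteChain.UniformlyConfining.lintegral_exp_mul_hamiltonian_langevinKernel_le_of_lt`
(`Literature/…/SiteChainExpBound.lean`: (3.3) `L e^{θH} ≤ θγ(T_L+T_R) e^{θH}` for smooth truncations,
Dynkin, Grönwall, Fatou) through `cellChain_uniformlyConfining`.

## References

* N. Cuneo, J.-P. Eckmann, M. Hairer, L. Rey-Bellet, EJP **23** (2018) no. 55, §3 eq. (3.4).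
-/

noncomputable section

open MeasureTheory Filter Topology
open scoped NNReal ENNReal
open Literature.MathematicalPhysics.KineticTheory.HeatConduction

namespace Summit.AtomisticToContinuum.FouriersLaw.Theorems.PrefixSteadyStates.LineRegistered

/-- **CEHR (3.4) for the Langevin kernels of a cell chain** (stub `stub_prefixExpBound` of the line
`PrefixSteadyStates`, registered skeleton r12): for `ω₂ > 0`, `lam, β ≥ 0`, `γ > 0`, every cell
indicator `c`, `N ≥ 1`, `T_L, T_R > 0` and `0 < θ < 1/max(T_L, T_R)`,
`∫ e^{θH} dP_t(z, ·) ≤ e^{θγ(T_L+T_R)t} e^{θH(z)}` for `P_t = (cellChain ω₂ lam β γ c).langevinKernel N T_L T_R t`.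
[cite: CuneoEckmannHairerReyBellet2018, §3 eq. (3.4)] -/
theorem stub_prefixExpBound :
    ∀ ω₂ lam β γ : ℝ, 0 < ω₂ → 0 ≤ lam → 0 ≤ β → 0 < γ → ∀ (c : ℕ → Bool) (N : ℕ), 0 < N →
      ∀ T_L T_R : ℝ, 0 < T_L → 0 < T_R → ∀ θ : ℝ, 0 < θ → θ < 1 / max T_L T_R →
        ∀ (t : ℝ≥0) (z : PhaseSpace N),
          ∫⁻ y, ENNReal.ofReal (Real.exp (θ * (cellChain ω₂ lam β γ c).hamiltonian N y))
              ∂((cellChain ω₂ lam β γ c).langevinKernel N T_L T_R t z) ≤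
            ENNReal.ofReal (Real.exp (θ * γ * (T_L + T_R) * t) *
              Real.exp (θ * (cellChain ω₂ lam β γ c).hamiltonian N z)) := by
  intro ω₂ lam β γ hω hl hβ hγ c N hN T_L T_R hTL hTR θ hθ hθ' t z
  have h := (cellChain_uniformlyConfining hω hl hβ hγ.le c).lintegral_exp_mul_hamiltonian_langevinKernel_le_of_lt
    hN hTL hTR hθ hθ' t z
  simpa only [cellChain_γ] using h

end Summit.AtomisticToContinuum.FouriersLaw.Theorems.PrefixSteadyStates.LineRegistered
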